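/-
Copyright (c) 2026. All rights reserved.
Released under Apache 2.0 license as described in the file LICENSE.
Authors: abc-iut cell, wave-5 seat abc-iut-w5-d141 (L3 sub-DAG [SemiAnbd] Thm 5.4, row T54-5b).
-/
import Literature.AnabelianGeometry.SemiGraphs.ArithQuasiGeometricRelSlim
import Literature.AnabelianGeometry.SemiGraphs.ArithEdgeLikeInfVerticial
import HarnessLib

/-!
# [SemiAnbd] Theorem 5.4 (iii), clause 1: geometric openness of `B^temp(φ)` on the kernel from the datum
# `ι = B^temp(−)|_{geom}` (sub-DAG SemiAnbd-Thm54, row T54-5b; proof-only)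

Mochizuki, *Semi-graphs of anabelioids*, Publ. RIMS **42** (2006), §5, Theorem 5.4 (iii), p. 66, clause 1
("applying `B^temp(−)` [to a locally open morphism over `A`] gives an arithmetically quasi-geometric morphism"),
whose geometric core is Prop 3.6 (iv) / Thm 3.7 (iv) for the geometric components
[cite: MochizukiSemiAnbd2006, Thm 5.4 (iii), p. 66].

PROOF-ONLY.  The coordinator's umbrella (abc-iut-w4-d085, `ArithThm54iiiAssembly.lean` /
`ArithThm54iiiUmbrella.lean`) takes, per locally open `φ` over `A`, the binders `hv` / `hb`: containment of the
arithmetic decomposition groups AND geometric openness of `B^temp(φ)` on `Π^temp_{𝔊,v} ∩ Ker augG` inside the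
geometric part of a conjugate of `Π^temp_{ℍ,f v}`.  This file derives the GEOMETRIC-OPENNESS clause (the input
`hgeo` of abc-iut-w4-d106's adapter `hv_of_geomOpen` / `hb_of_geomOpen`, which then supplies the containment clause
from the commensurator description of p. 65) from the SAME producer datum as rows T54-6b / T54-7
(`ArithQuasiGeometricInjective.lean`, `ArithQuasiGeometricSurjective.lean`, abc-iut-w5-d141):
`ι : (𝔾 ⟶ ℍ) → (Ker augG →* Π^temp_ℍ)` = "`B^temp` on the geometric tempered groups", its tie `hιbtemp` to the
arithmetic `B^temp` (agreement on the kernel up to a geometric inner automorphism), and the ι-level statement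
`hιgeomV` / `hιgeomE` = Prop 3.6 (iv) / Thm 3.7 (iv) for the geometric components (sub-DAG Cor39 rows R0′/R1
through the tempered chart): `ι g` maps the geometric part of `Π^temp_{𝔊,v}` onto an OPEN subgroup of the
geometric part of a conjugate of `Π^temp_{ℍ,w}`.  Mechanism: `B^temp(φ) = δ · ι(φ.geom) · δ⁻¹` on the kernel, and
"maps onto an open subgroup of" is transported along conjugation by `δ` (`mapsOntoOpen_conj`; iterated conjugation `conjSubgroup_conjSubgroup` REUSED from
abc-iut-w4-d085's `ArithEdgeLikeInfVerticial.lean`).  Nothing asserted;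
no side on [IUTchIII] Cor 3.12.
-/

namespace Literature.AnabelianGeometry.SemiGraphs

open _root_.CategoryTheory

universe u v w uG uH uP uV uB uV' uB'

/-! ### Transport of "maps onto an open subgroup of" along a kernel agreement and a conjugation -/

section Transport

variable {Gtp : Type uG} [Group Gtp]
variable {Htp : Type uH} [Group Htp] [TopologicalSpace Htp] [IsTopologicalGroup Htp]
variable {PA : Type uP} [Group PA]
variable {augG : Gtp →* PA} {augH' : Htp →* PA}

omit [TopologicalSpace Htp] [IsTopologicalGroup Htp] in
/-- If `f = δ · ιg · δ⁻¹` on `Ker augG`, the image under `f` of a subgroup `A ⊆ Ker augG` is the `δ`-conjugate of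
its image under `ιg`. [cite: MochizukiSemiAnbd2006, Thm 5.4 (iii), p. 66] -/
theorem map_eq_conjSubgroup_map_of_kerAgree {f : Gtp →* Htp} {ιg : augG.ker →* Htp} {δ : Htp}
    (hδ : ∀ x : augG.ker, f x = δ * ιg x * δ⁻¹) (A : Subgroup Gtp) (hA : A ≤ augG.ker) :
    A.map f = conjSubgroup δ ((A.subgroupOf augG.ker).map ιg) := by
  ext y
  constructor
  · rintro ⟨a, ha, rfl⟩
    refine ⟨ιg ⟨a, hA ha⟩, ⟨⟨a, hA ha⟩, Subgroup.mem_subgroupOf.mpr ha, rfl⟩, ?_⟩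
    rw [hδ ⟨a, hA ha⟩]
    simp only [MulEquiv.coe_toMonoidHom, MulAut.conj_apply]
  · rintro ⟨_, ⟨a, ha, rfl⟩, rfl⟩
    refine ⟨a, Subgroup.mem_subgroupOf.mp ha, ?_⟩
    rw [hδ a]
    simp only [MulEquiv.coe_toMonoidHom, MulAut.conj_apply]

/-- "Contained in, and open in" is transported along conjugation by `δ`.
[cite: MochizukiSemiAnbd2006, Thm 5.4 (iii), p. 66] -/
theorem mapsOntoOpen_conj {S M : Subgroup Htp} (hle : S ≤ M)
    (hopen : IsOpen ((Subtype.val : M → Htp) ⁻¹' (S : Set Htp))) (δ : Htp) :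
    conjSubgroup δ S ≤ conjSubgroup δ M ∧
      IsOpen ((Subtype.val : conjSubgroup δ M → Htp) ⁻¹' (conjSubgroup δ S : Set Htp)) := by
  refine ⟨Subgroup.map_mono hle, ?_⟩
  -- `y ↦ δ⁻¹ y δ : δ M δ⁻¹ → M` is continuous and pulls `S` back to `δ S δ⁻¹`
  have hmem : ∀ y : conjSubgroup δ M, δ⁻¹ * (y : Htp) * δ ∈ M := by
    rintro ⟨_, ⟨m, hm, rfl⟩⟩
    simpa [MulAut.conj_apply, mul_assoc] using hm
  let ψ : conjSubgroup δ M → M := fun y => ⟨δ⁻¹ * (y : Htp) * δ, hmem y⟩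
  have hψ : Continuous ψ :=
    ((continuous_const.mul continuous_subtype_val).mul continuous_const).subtype_mk _
  have hset : (Subtype.val : conjSubgroup δ M → Htp) ⁻¹' (conjSubgroup δ S : Set Htp) =
      ψ ⁻¹' ((Subtype.val : M → Htp) ⁻¹' (S : Set Htp)) := by
    ext ⟨y, hy⟩
    simp only [Set.mem_preimage, SetLike.mem_coe, ψ]
    constructor
    · rintro ⟨s, hs, rfl⟩
      simpa [MulAut.conj_apply, mul_assoc] using hs
    · intro h
      exact ⟨δ⁻¹ * y * δ, h, by simp [MulAut.conj_apply, mul_assoc]⟩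
  rw [hset]
  exact hopen.preimage hψ

/-- **Geometric openness on the kernel, transported from `ι` to `B^temp(φ)`**: if `f = δ · ιg · δ⁻¹` on
`Ker augG` and `ιg` maps `A = K ∩ Ker augG` into `x M x⁻¹ ∩ Ker augH'` with open image, then `f` maps `A` onto an
open subgroup of `(δx) M (δx)⁻¹ ∩ Ker augH'`. [cite: MochizukiSemiAnbd2006, Thm 5.4 (iii), p. 66] -/
theorem mapsOntoOpenSubgroupOf_of_kerAgree {f : Gtp →* Htp} {ιg : augG.ker →* Htp} {δ : Htp}
    (hδ : ∀ x : augG.ker, f x = δ * ιg x * δ⁻¹) (K : Subgroup Gtp) (M : Subgroup Htp) (x : Htp)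
    (hle : ((K ⊓ augG.ker).subgroupOf augG.ker).map ιg ≤ conjSubgroup x M ⊓ augH'.ker)
    (hopen : IsOpen ((Subtype.val : (conjSubgroup x M ⊓ augH'.ker : Subgroup Htp) → Htp) ⁻¹'
      (((K ⊓ augG.ker).subgroupOf augG.ker).map ιg : Set Htp))) :
    MapsOntoOpenSubgroupOf f (K ⊓ augG.ker) (conjSubgroup (δ * x) M ⊓ augH'.ker) := by
  have htarget : conjSubgroup (δ * x) M ⊓ augH'.ker = conjSubgroup δ (conjSubgroup x M ⊓ augH'.ker) := by
    rw [conjSubgroup_inf_ker, conjSubgroup_inf_ker, conjSubgroup_conjSubgroup]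
  unfold MapsOntoOpenSubgroupOf
  rw [htarget, map_eq_conjSubgroup_map_of_kerAgree hδ _ inf_le_right]
  exact mapsOntoOpen_conj hle hopen δ

end Transport

/-! ### Row T54-5b: the geometric-openness clause of `hv` / `hb` from the datum `ι` -/

section Main

variable {Obj : Type u} [Category.{v} Obj] {𝓥 : SemiAnbdVocab.{u, v, w} Obj}
variable {𝔊 ℍ : ArithSemiGraph 𝓥} {e : 𝔊.PA ≃* ℍ.PA}
variable {Gtp : Type uG} [Group Gtp] [TopologicalSpace Gtp]
variable {Htp : Type uH} [Group Htp] [TopologicalSpace Htp] [IsTopologicalGroup Htp]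
variable {V : Type uV} {B : Type uB} {V' : Type uV'} {B' : Type uB'}
variable {D : DecompositionData Gtp V B} {D' : DecompositionData Htp V' B'}

omit [TopologicalSpace Gtp] in
/-- **Row T54-5b, vertices.** For every locally open `φ` over `A`, `B^temp(φ)` maps `Π^temp_{𝔊,v} ∩ Ker augG` onto
an OPEN subgroup of the geometric part of a conjugate of `Π^temp_{ℍ,f v}` — the geometric-openness half of the
umbrella's binder `hv` (= the input `hgeo` of `hv_of_geomOpen`) — from `hιbtemp` (`B^temp(φ) = δ · ι(φ.geom) · δ⁻¹`
on the kernel) and the ι-level Prop 3.6 (iv) / Thm 3.7 (iv) statement `hιgeomV` for the geometric components.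
[cite: MochizukiSemiAnbd2006, Thm 5.4 (iii), p. 66] -/
theorem Thm54iii.geomOpenV_of_iota (augG : Gtp →* 𝔊.PA) (augH' : Htp →* 𝔊.PA)
    (btemp : (φ : ArithHom 𝓥 𝔊 ℍ) → φ.IsLocallyOpen → ArithHom.IsOverA 𝔊 ℍ e φ → (Gtp →* Htp))
    (ι : (𝔊.G ⟶ ℍ.G) → (augG.ker →* Htp))
    (hιbtemp : ∀ (φ : ArithHom 𝓥 𝔊 ℍ) (h₁ : φ.IsLocallyOpen) (h₂ : ArithHom.IsOverA 𝔊 ℍ e φ),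
      ∃ δ ∈ augH'.ker, ∀ x : augG.ker, btemp φ h₁ h₂ x = δ * ι φ.geom x * δ⁻¹)
    (hιgeomV : ∀ g : 𝔊.G ⟶ ℍ.G, ∃ fv : V → V', ∀ v : V, ∃ x : Htp,
      ((D.vertGp v ⊓ augG.ker).subgroupOf augG.ker).map (ι g) ≤
          conjSubgroup x (D'.vertGp (fv v)) ⊓ augH'.ker ∧
        IsOpen ((Subtype.val : (conjSubgroup x (D'.vertGp (fv v)) ⊓ augH'.ker : Subgroup Htp) → Htp) ⁻¹'
          (((D.vertGp v ⊓ augG.ker).subgroupOf augG.ker).map (ι g) : Set Htp)))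
    (φ : ArithHom 𝓥 𝔊 ℍ) (h₁ : φ.IsLocallyOpen) (h₂ : ArithHom.IsOverA 𝔊 ℍ e φ) :
    ∃ fv : V → V', ∀ v : V, ∃ g : Htp,
      MapsOntoOpenSubgroupOf (btemp φ h₁ h₂) (D.vertGp v ⊓ augG.ker)
        (conjSubgroup g (D'.vertGp (fv v)) ⊓ augH'.ker) := by
  obtain ⟨δ, -, hδ⟩ := hιbtemp φ h₁ h₂
  obtain ⟨fv, hfv⟩ := hιgeomV φ.geom
  refine ⟨fv, fun v => ?_⟩
  obtain ⟨x, hle, hopen⟩ := hfv v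
  exact ⟨δ * x, mapsOntoOpenSubgroupOf_of_kerAgree hδ _ _ x hle hopen⟩

omit [TopologicalSpace Gtp] in
/-- **Row T54-5b, branches.** The same for the decomposition groups of branches (`hb`'s geometric-openness half
= the input `hgeo` of `hb_of_geomOpen`), from `hιbtemp` and the ι-level statement `hιgeomE` for edge-like
subgroups of the geometric components. [cite: MochizukiSemiAnbd2006, Thm 5.4 (iii), p. 66] -/
theorem Thm54iii.geomOpenE_of_iota (augG : Gtp →* 𝔊.PA) (augH' : Htp →* 𝔊.PA)
    (btemp : (φ : ArithHom 𝓥 𝔊 ℍ) → φ.IsLocallyOpen → ArithHom.IsOverA 𝔊 ℍ e φ → (Gtp →* Htp))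
    (ι : (𝔊.G ⟶ ℍ.G) → (augG.ker →* Htp))
    (hιbtemp : ∀ (φ : ArithHom 𝓥 𝔊 ℍ) (h₁ : φ.IsLocallyOpen) (h₂ : ArithHom.IsOverA 𝔊 ℍ e φ),
      ∃ δ ∈ augH'.ker, ∀ x : augG.ker, btemp φ h₁ h₂ x = δ * ι φ.geom x * δ⁻¹)
    (hιgeomE : ∀ g : 𝔊.G ⟶ ℍ.G, ∃ fb : B → B', ∀ b : B, ∃ x : Htp,
      ((D.brGp b ⊓ augG.ker).subgroupOf augG.ker).map (ι g) ≤
          conjSubgroup x (D'.brGp (fb b)) ⊓ augH'.ker ∧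
        IsOpen ((Subtype.val : (conjSubgroup x (D'.brGp (fb b)) ⊓ augH'.ker : Subgroup Htp) → Htp) ⁻¹'
          (((D.brGp b ⊓ augG.ker).subgroupOf augG.ker).map (ι g) : Set Htp)))
    (φ : ArithHom 𝓥 𝔊 ℍ) (h₁ : φ.IsLocallyOpen) (h₂ : ArithHom.IsOverA 𝔊 ℍ e φ) :
    ∃ fb : B → B', ∀ b : B, ∃ g : Htp,
      MapsOntoOpenSubgroupOf (btemp φ h₁ h₂) (D.brGp b ⊓ augG.ker)
        (conjSubgroup g (D'.brGp (fb b)) ⊓ augH'.ker) := by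
  obtain ⟨δ, -, hδ⟩ := hιbtemp φ h₁ h₂
  obtain ⟨fb, hfb⟩ := hιgeomE φ.geom
  refine ⟨fb, fun b => ?_⟩
  obtain ⟨x, hle, hopen⟩ := hfb b
  exact ⟨δ * x, mapsOntoOpenSubgroupOf_of_kerAgree hδ _ _ x hle hopen⟩

end Main

end Literature.AnabelianGeometry.SemiGraphs
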